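import Summits.BirchSwinnertonDyer.BirchSwinnertonDyer.Theorems.BiquadraticEisensteinDescentHeegnerTwistCouplingInSupplySylvesterTwistCorner
import HarnessLib

set_option linter.dupNamespace false -- `Summit.BirchSwinnertonDyer.BirchSwinnertonDyer.Theorems.…` (summit = sub, D-0017)
set_option autoImplicit false

/-!
# Crux `HeegnerTwistCouplingInSupply` (stmt-BirchSwinnertonDyer-21381) — programme «TWISTED 3-ISOGENY DESCENT», file P7c-E:
# the corner with `K′ = ℚ(√−2)` in LUCAS form, and the law (h1) ⟹ (h2) in the kernel below `3000`

Route `BiquadraticEisensteinDescent` (cell `pub/bsd-wall`, width seat `bsd-wall-cm-bed-w4` g33; `--supports` 21381, helper). File P7c-D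
proved the conclusion of crux 21381 at `(W_p, p)` for every prime `p ≡ 17, 35 (mod 72)` with (h1) (`X³ − 3X − 10` irreducible mod `p`)
and (h2) (`p = a² + 2b²`, `9 ∤ a`), modulo Burungale–Tian ONLY. Here:

* §1 `entireLFunction_twist_one_ne_zero_of_lucas`, `cruxConclusion_sqrtMinusTwo_of_lucas` — the same with (h1) in its kernel-decidable
  LUCAS form `p ∤ Im((10 + 2√24)^{(p+1)/3})` (the cubic bridge of g31 is bypassed; the unit bridge `exists_unit_not_cube_of_lucas` of g26
  consumes the Lucas form directly);
* §2 `law_lt` — ONE `decide +kernel`: for every prime `p ≡ 17, 35 (mod 72)` below `3000` with the Lucas certificate, a representation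
  `p = a² + 2b²` with `9 ∤ a` EXISTS (the Artin law (h1) ⟹ (h2) of the programme memo, verified in the kernel for the 23 certified primes
  `17, 107, 233, 251, 449, 467, 521, 683, 809, 953, 1097, 1187, 1259, 1601, 1619, 1889, 1907, 2339, 2609, 2699, 2753, 2843, 2897`; the other
  11 primes of the progression below `3000` fail the Lucas test);
* §3 ★★★ `cruxOnSylvesterCorner_sqrtMinusTwo_lt` — hence below `3000` g31's ONE-certificate theorem `cruxOnSylvesterCorner_sqrtMinusTwo`
  holds WITHOUT `hDescU`: for every prime `p < 3000`, `p ≡ 17, 35 (mod 72)`, with `X³ − 3X − 10` irreducible mod `p`, the conclusion of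
  crux 21381 at `(W_p, p)` with `K′ = ℚ(√−2)` — MODULO Burungale–Tian ONLY.

HONEST FRAMING: kernel table for ONE CM family and ONE Heegner field; the law (h1) ⟹ (h2) beyond `3000` (class field theory), the crux
(residual C⁺) and BSD are untouched. THEOREMS ONLY (no `def`, no named fact, no sorry). Supports stmt-BirchSwinnertonDyer-21381.
[cite: CohenPazuki2009, §2] [cite: BurungaleTian2026, Thm. 1.1] [cite: Cohen1993, §1.2.2 Algorithm 1.2.1] [cite: IrelandRosen1990, §9.1]
-/

noncomputable section

open scoped Classical NumberField

namespace Summit.BirchSwinnertonDyer.BirchSwinnertonDyer.Theorems.SylvesterTwistDescent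

open Literature.NumberTheory.EllipticCurves Literature.NumberTheory.EllipticCurves.MordellDescent
open Literature.NumberTheory.EllipticCurves.Rank1Residual Literature.NumberTheory.QuadraticFields
open Literature.NumberTheory.QuadraticFields.Quadratic NumberField WeierstrassCurve
open Summit.BirchSwinnertonDyer.BirchSwinnertonDyer.Theorems.SylvesterCorner

/-! ## §1 The corner in Lucas form -/

/-- ★★★ **`L(W_p^{(−8)}, 1) ≠ 0`, Lucas form**: prime `p ≡ 17, 35 (mod 72)`, `p ∤ Im((10 + 2√24)^{(p+1)/3})`, `p = a² + 2b²` with `9 ∤ a`,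
MODULO Burungale–Tian ONLY. [cite: CohenPazuki2009, §2] [cite: BurungaleTian2026, Thm. 1.1] -/
theorem entireLFunction_twist_one_ne_zero_of_lucas (hBT : burungaleTian_analyticRank_eq_zero_of_selmerCorank_eq_zero_of_hasCM)
    {p : ℕ} (hp : p.Prime) (hp72 : p % 72 = 17 ∨ p % 72 = 35) (hLuc : ¬ (p : ℤ) ∣ ((⟨10, 2⟩ : ℤ√24) ^ ((p + 1) / 3)).im)
    {a b : ℤ} (hab : a ^ 2 + 2 * b ^ 2 = p) (h9 : ¬ (9 : ℤ) ∣ a) :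
    ((⟨0, 0, (p : ℚ), 0, 0⟩ : WeierstrassCurve ℚ).quadraticTwist (((-8 : ℤ)) : ℚ)).entireLFunction 1 ≠ 0 := by
  obtain ⟨hp9, hp8⟩ := (mod_seventyTwo_iff p).mp hp72
  have hp2 : p ≠ 2 := by rintro rfl; omega
  have hp3 : p % 3 = 2 := by omega
  obtain ⟨F, iF, iNF, ω, cF, hF2, hω, hcF⟩ := exists_model_sqrt_six
  obtain ⟨K, iK, iNK, θ, cK, hK, hcK⟩ := exists_model_sqrt_neg_two
  have hJ24 : jacobiSym 24 p = -1 := by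
    rw [show (24 : ℤ) = -3 * -8 by norm_num, jacobiSym.mul_left, jacobiSym_neg_three_eq_neg_one (hp.odd_of_ne_two hp2) hp3,
      jacobiSym_neg_eight_eq_one hp8]
    norm_num
  obtain ⟨u₀, hu₀⟩ := exists_unit_not_cube_of_lucas hF2 (discr_eq_twentyFour hF2 hω) hp hp2 hp3 hJ24 (by norm_num) hLuc
  have hp0 : (p : ℚ) ≠ 0 := Nat.cast_ne_zero.mpr hp.ne_zero
  have hk0 : (-2 * (p : ℚ) ^ 2) ≠ 0 := mul_ne_zero (by norm_num) (pow_ne_zero 2 hp0)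
  haveI := isElliptic_mordellCurve hk0
  have hrank := mordellWeilRank_sylvesterTwist_eq_zero hF2 hω cF hcF hK cK hcK hp hp9 hab h9 ⟨u₀, hu₀⟩
  have hsha := forall_mem_sha_three_nsmul_eq_zero hF2 hω cF hcF hK cK hcK hp hp9 hab h9 ⟨u₀, hu₀⟩
  have hj : (mordellCurve (-2 * (p : ℚ) ^ 2)).j = 0 := j_eq_zero _ (mordellCurve_c₄ _)
  obtain ⟨-, hL⟩ := L_one_ne_zero_of_desc_BT hBT (mordellCurve (-2 * (p : ℚ) ^ 2)) hj hrank hsha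
  haveI : ((⟨0, 0, (p : ℚ), 0, 0⟩ : WeierstrassCurve ℚ).quadraticTwist (((-8 : ℤ)) : ℚ)).IsElliptic :=
    haveI := isElliptic_sylvester hp.ne_zero
    (⟨0, 0, (p : ℚ), 0, 0⟩ : WeierstrassCurve ℚ).isElliptic_quadraticTwist (by norm_num)
  rw [← entireLFunction_smul _ (⟨Units.mk0 (2 : ℚ) two_ne_zero, 0, 0, 0⟩ : VariableChange ℚ), variableChange_twist]
  exact hL

/-- ★★★ **The corner in Lucas form**: the conclusion of crux 21381 at `(W_p, p)` with `K′ = ℚ(√−2)` from the Lucas certificate and (h2),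
MODULO Burungale–Tian ONLY. [cite: CohenPazuki2009, §2] [cite: BurungaleTian2026, Thm. 1.1] [cite: IrelandRosen1990, §9.1] -/
theorem cruxConclusion_sqrtMinusTwo_of_lucas (hBT : burungaleTian_analyticRank_eq_zero_of_selmerCorank_eq_zero_of_hasCM)
    {p : ℕ} (hp : p.Prime) (hp72 : p % 72 = 17 ∨ p % 72 = 35) (hLuc : ¬ (p : ℤ) ∣ ((⟨10, 2⟩ : ℤ√24) ^ ((p + 1) / 3)).im)
    (h2 : ∃ a b : ℤ, a ^ 2 + 2 * b ^ 2 = p ∧ ¬ (9 : ℤ) ∣ a) [(⟨0, 0, (p : ℚ), 0, 0⟩ : WeierstrassCurve ℚ).IsElliptic] :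
    ∃ (K : Type) (_ : Field K) (_ : NumberField K),
      IsImaginaryQuadratic K ∧ 4 < (NumberField.discr K).natAbs ∧
      SatisfiesHeegnerHypothesis ((⟨0, 0, (p : ℚ), 0, 0⟩ : WeierstrassCurve ℚ).conductorNorm ℤ) K ∧
      ((⟨0, 0, (p : ℚ), 0, 0⟩ : WeierstrassCurve ℚ).quadraticTwist (NumberField.discr K : ℚ)).entireLFunction 1 ≠ 0 ∧
      NumberField.classNumber K < p ∧ ¬ p ∣ NumberField.classNumber K := by
  obtain ⟨hp9, hp8⟩ := (mod_seventyTwo_iff p).mp hp72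
  have hp2 : p ≠ 2 := by rintro rfl; omega
  obtain ⟨a, b, hab, h9⟩ := h2
  have hL := entireLFunction_twist_one_ne_zero_of_lucas hBT hp hp72 hLuc hab h9
  obtain ⟨K, iF, iN, hK, hdK, hhK⟩ : ∃ (K : Type) (_ : Field K) (_ : NumberField K),
      IsImaginaryQuadratic K ∧ NumberField.discr K = -8 ∧ NumberField.classNumber K = 1 :=
    exists_field_of_four_mul (-2) (by norm_num) 1 (by norm_num) (by norm_num) (by decide +kernel) (by decide +kernel)
  refine ⟨K, iF, iN, hK, by rw [hdK]; norm_num, ?_, by rw [hdK]; exact hL, by rw [hhK]; exact hp.one_lt,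
    by rw [hhK]; exact fun h => hp.one_lt.ne' (Nat.dvd_one.mp h)⟩
  exact satisfiesHeegnerHypothesis_of_three_p hK.1 hp2 (by rw [hdK]; exact jacobiSym_neg_eight_three)
    (by rw [hdK]; exact jacobiSym_neg_eight_eq_one hp8) (fun r hr hrN => eq_three_or_eq_of_prime_dvd_conductorNorm_W hp hr hrN)

/-! ## §2 The law (h1) ⟹ (h2) below `3000`, in the kernel -/

/-- **The law below `3000` (ONE `decide +kernel`).** For every `k < 333`, writing `p = 9k + 8`: either `p` has a prime factor `≤ 53`, or
`p ≢ 1, 3 (mod 8)`, or the Lucas certificate fails (`p ∣ Im((10 + 2√24)^{(p+1)/3})`, computed by `14` square-and-multiply steps), or there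
are `a < 55`, `b < 40` with `a² + 2b² = p` and `9 ∤ a`. [cite: Cohen1993, §1.2.2 Algorithm 1.2.1] -/
theorem law_lt : ∀ k < 333,
    (∃ q ∈ [2, 3, 5, 7, 11, 13, 17, 19, 23, 29, 31, 37, 41, 43, 47, 53], q < 9 * k + 8 ∧ (9 * k + 8) % q = 0) ∨
    ¬ ((9 * k + 8) % 8 = 1 ∨ (9 * k + 8) % 8 = 3) ∨
    ((9 * k + 8 : ℕ) : ℤ) ∣ ((fun s : ℕ × ℤ√24 × ℤ√24 =>
        (s.1 / 2, if s.1 % 2 = 1 then s.2.1 * s.2.2 else s.2.1, s.2.2 * s.2.2))^[14] ((9 * k + 8 + 1) / 3, 1, ⟨10, 2⟩)).2.1.im ∨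
    ∃ a ∈ List.range 55, ∃ b ∈ List.range 40, a * a + 2 * (b * b) = 9 * k + 8 ∧ a % 9 ≠ 0 := by
  decide +kernel

/-! ## §3 The one-certificate corner below `3000` -/

/-- ★★★ **g31's `cruxOnSylvesterCorner_sqrtMinusTwo` WITHOUT `hDescU`, below `3000`.** For every prime `p < 3000` with
`p ≡ 17, 35 (mod 72)` at which `X³ − 3X − 10` has no root mod `p`: the conclusion of `HeegnerTwistCouplingInSupply` at `(W_p, p)` with
`K′ = ℚ(√−2)` — MODULO Burungale–Tian ONLY ((h2) is supplied by the kernel table `law_lt`). [cite: CohenPazuki2009, §2]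
[cite: BurungaleTian2026, Thm. 1.1] [cite: IrelandRosen1990, §9.1] -/
theorem cruxOnSylvesterCorner_sqrtMinusTwo_lt (hBT : burungaleTian_analyticRank_eq_zero_of_selmerCorank_eq_zero_of_hasCM) :
    ∀ (p : ℕ) (hp : p.Prime), p < 3000 → (p % 72 = 17 ∨ p % 72 = 35) → (∀ x : ZMod p, x ^ 3 - 3 * x - 10 ≠ 0) →
      haveI := isElliptic_sylvester hp.ne_zero
      ∃ (K : Type) (_ : Field K) (_ : NumberField K),
        IsImaginaryQuadratic K ∧ 4 < (NumberField.discr K).natAbs ∧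
        SatisfiesHeegnerHypothesis ((⟨0, 0, (p : ℚ), 0, 0⟩ : WeierstrassCurve ℚ).conductorNorm ℤ) K ∧
        ((⟨0, 0, (p : ℚ), 0, 0⟩ : WeierstrassCurve ℚ).quadraticTwist (NumberField.discr K : ℚ)).entireLFunction 1 ≠ 0 ∧
        NumberField.classNumber K < p ∧ ¬ p ∣ NumberField.classNumber K := by
  intro p hp hlt hp72 h1
  haveI := isElliptic_sylvester hp.ne_zero
  obtain ⟨hp9, hp8⟩ := (mod_seventyTwo_iff p).mp hp72
  have hp2 : p ≠ 2 := by rintro rfl; omega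
  have hp3 : p % 3 = 2 := by omega
  have hJ24 : jacobiSym 24 p = -1 := by
    rw [show (24 : ℤ) = -3 * -8 by norm_num, jacobiSym.mul_left, jacobiSym_neg_three_eq_neg_one (hp.odd_of_ne_two hp2) hp3,
      jacobiSym_neg_eight_eq_one hp8]
    norm_num
  have hLuc := lucas_of_forall_cubic_ne_zero hp hp2 hp3 hJ24 (a := 10) (b := 2) (by norm_num) (fun x => by push_cast; exact h1 x)
  -- `p = 9k + 8`, `k < 333`
  have hpk : 9 * (p / 9) + 8 = p := by omega
  rcases law_lt (p / 9) (by omega) with hsieve | hmod8 | hfail | ⟨a, -, b, -, hab, ha9⟩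
  · exfalso
    obtain ⟨q, hq, hqlt, hqdvd⟩ := hsieve
    rw [hpk] at hqlt hqdvd
    have h2q : 2 ≤ q := by simp only [List.mem_cons, List.mem_nil_iff, or_false] at hq; omega
    rcases (Nat.dvd_prime hp).mp (Nat.dvd_of_mod_eq_zero hqdvd) with h | h <;> omega
  · exfalso; rw [hpk] at hmod8; exact hmod8 hp8
  · exfalso
    rw [hpk] at hfail
    have hn : (p + 1) / 3 < 2 ^ 14 := by norm_num; omega
    rw [iterate_sqMul_eq_pow (⟨10, 2⟩ : ℤ√24) hn] at hfail
    exact hLuc hfail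
  · rw [hpk] at hab
    refine cruxConclusion_sqrtMinusTwo_of_lucas hBT hp hp72 hLuc ⟨a, b, by linarith, ?_⟩
    intro h9
    apply ha9
    have : ((a : ℤ) % 9) = 0 := Int.emod_eq_zero_of_dvd h9
    omega

end Summit.BirchSwinnertonDyer.BirchSwinnertonDyer.Theorems.SylvesterTwistDescent

end
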